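import Summits.BirchSwinnertonDyer.BirchSwinnertonDyer.Theorems.MordellShaFreeCutBDPTripleUpToCensus
import Literature.NumberTheory.GaloisCohomology.PoitouTateTotallyComplex

set_option linter.dupNamespace false
set_option autoImplicit false

/-! # Route `MordellShaFreeCut` (rung S2b) — the kernel census MODULO THE CORRECTION AT `p` ONLY:
the textbook input `stub_textbookDualityImQuad` (Poitou–Tate at the imaginary quadratic fields) is
replaced by the one elementary statement the cell's (F1) campaign has not yet landed — the
pre-reduction `exists_correction_trivial_above_p` (Tate, Cassels–Fröhlich VII §11; node T-pre) at the
imaginary quadratic fields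

Cell `bsd-cn100`, prover seat `bsd-cn100-s2b-c3` (g4). Supports, does not close, stmt-BirchSwinnertonDyer-19160.
After 2026-08-26T13:54Z the tree holds `poitouTate_sum_localTatePairing_eq_zero_of_isTotallyComplex_of_correction`
(`PoitouTateTotallyComplex.lean`, transfer-2 g4): Poitou–Tate for a totally complex number field GRANTED the
correction statement `hpre` (for every prime `p` and `m`, every class `y ∈ H²(Γ_K, μ_{p^(m+1)})` with finite
support `S` can be replaced, at a higher level `p^e`, by a class `y'` VANISHING AT THE PLACES ABOVE `p`, with
controlled support `S' ⊇ S` and the same invariant sum up to the level factor `p^(e−m−1)`) — the statement of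
the campaign's last open node (ty g6, `BrauerClassCorrectionAtP.lean`). This file reads the S2b census of
`MordellShaFreeCutPoitouTateImQuad.lean` (exact BDP triple, p448851) and of
`MordellShaFreeCutBDPTripleUpToCensus.lean` (♯ triple, p451012) with `hPT` DISCHARGED down to `hpre` at the
imaginary quadratic fields (`IsImaginaryQuadratic.isTotallyComplex`):

* `poitouTate_imaginaryQuadratic_of_correction` — the registered stub statement
  `∀ K, IsImaginaryQuadratic K → poitouTate_sum_localTatePairing_eq_zero K` ⟸ `hpre` at those `K`;
* `cruxB_of_bdpTriple_of_correction`, `cruxB_of_bdpTripleUpTo_of_correction` — **crux B ⟸ BDP triple (exact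
  or ♯) + six refereed facts + the correction statement at imaginary quadratic fields**;
* `cruxA_iff_res_of_bdpTriple_of_correction`, `leaf_of_res_of_bdpTriple_of_correction`,
  `leaf_of_res_of_bdpTripleUpTo_of_correction` — the residual's and the route's census likewise.

So, in the kernel, as of this file: the ONLY inputs of crux B that are neither research statements at the
additive prime `3` ((LB-exist)/(LB-wan)/(LB-bdp) or their ♯ forms) nor refereed named facts is the
elementary correction statement `hpre`; when T-pre lands, `hpre` is discharged by one term. HONEST FRAMING:
CONDITIONAL reductions; nothing here proves crux A, crux B, the leaf, Sylvester's conjecture or any case of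
BSD. PARTITION: none — RANK axis.

[cite: CasselsFrohlichANT1967, Ch. VII §11 (the correction by auxiliary cyclotomic classes)]
[cite: MilneADT2006, Ch. I, Thm. 4.10(b)] [cite: GrossZagier1986, Thm. I.6.3 with V.§2]
[cite: CastellaGrossiLeeSkinner2022, §5.2 (proof of Thm. 5.2.1)] -/

noncomputable section

open scoped Classical

namespace Summit.BirchSwinnertonDyer.BirchSwinnertonDyer.Theorems.MordellShaFreeCutCensusModCorrection

open PowerSeries WeierstrassCurve NumberField IsDedekindDomain Field Literature.NumberTheory.EllipticCurves
  Literature.NumberTheory.EllipticCurves.ModularForms Literature.NumberTheory.QuadraticFields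
  Literature.NumberTheory.EllipticCurves.Castella2018
open Literature.NumberTheory.GaloisRepresentations Literature.NumberTheory.GaloisCohomology
open Literature.NumberTheory.GaloisRepresentations.DiscreteGaloisModule (mu)
open Summit.BirchSwinnertonDyer.BirchSwinnertonDyer.Theses.MordellShaFreeCut
open Summit.BirchSwinnertonDyer.BirchSwinnertonDyer.Theorems.MordellShaFreeCutThreeAdicBDPTriple
  (ThreeAdicBDPElementExists ThreeAdicWanDivisibility ThreeAdicBDPValueAtOne)
open Summit.BirchSwinnertonDyer.BirchSwinnertonDyer.Theorems.MordellShaFreeCutThreeAdicBDPTripleUpTo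
  (ThreeAdicBDPElementExistsUpTo ThreeAdicWanDivisibilityUpTo ThreeAdicBDPValueAtOneUpTo)
open Summit.BirchSwinnertonDyer.BirchSwinnertonDyer.Theorems.MordellShaFreeCutPoitouTateImQuad
  (cruxB_of_bdpTriple_of_poitouTate_imaginaryQuadratic cruxA_iff_res_of_bdpTriple_of_poitouTate_imaginaryQuadratic
    leaf_of_res_of_bdpTriple_of_poitouTate_imaginaryQuadratic)
open Summit.BirchSwinnertonDyer.BirchSwinnertonDyer.Theorems.MordellShaFreeCutBDPTripleUpToCensus
  (leaf_of_res_of_bdpTripleUpTo_of_poitouTate_imaginaryQuadratic)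
open Summit.BirchSwinnertonDyer.BirchSwinnertonDyer.Theorems.MordellShaFreeCutThreeAdicBDPTripleUpTo
  (cruxB_of_bdpTripleUpTo_of_poitouTate_imaginaryQuadratic)

/-! ## 1. Poitou–Tate at the imaginary quadratic fields from the correction statement -/

/-- **The registered textbook stub statement from the correction statement**: for every imaginary quadratic
`K` (totally complex, `IsImaginaryQuadratic.isTotallyComplex`) the tree's
`poitouTate_sum_localTatePairing_eq_zero_of_isTotallyComplex_of_correction` (transfer-2 g4, N6 assembly of
the (F1) campaign: T-kill + T-surj + T-eval + level changes + complex places) gives Poitou–Tate granted the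
correction at every prime. CONDITIONAL on `hpre`; credits nothing. [cite: MilneADT2006, Ch. I, Thm. 4.10(b)]
[cite: CasselsFrohlichANT1967, Ch. VII §11] -/
theorem poitouTate_imaginaryQuadratic_of_correction
    (hpre : ∀ (K : Type) [Field K] [NumberField K], IsImaginaryQuadratic K →
      ∀ (p : ℕ) [Fact p.Prime] (m : ℕ) (y : galoisCohomology (mu K (p ^ (m + 1))) 2)
        (S : Finset (HeightOneSpectrum (𝓞 K))),
        (∀ v ∉ S, localInvariantMap K (p ^ (m + 1)) v
          (galoisCohomology.localization (mu K (p ^ (m + 1))) (Sum.inr v) 2 y) = 0) →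
        ∃ e : ℕ, m + 1 ≤ e ∧ ∃ (y' : galoisCohomology (mu K (p ^ e)) 2) (S' : Finset (HeightOneSpectrum (𝓞 K))),
          S ⊆ S' ∧
          (∀ v : HeightOneSpectrum (𝓞 K), (p : 𝓞 K) ∈ v.asIdeal →
            galoisCohomology.localization (mu K (p ^ e)) (Sum.inr v) 2 y' = 0) ∧
          (∀ v ∉ S', localInvariantMap K (p ^ e) v
            (galoisCohomology.localization (mu K (p ^ e)) (Sum.inr v) 2 y') = 0) ∧
          (∀ T : Finset (HeightOneSpectrum (𝓞 K)), S' ⊆ T →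
            ∑ v ∈ T, localInvariantMap K (p ^ e) v (galoisCohomology.localization (mu K (p ^ e)) (Sum.inr v) 2 y') =
              (((∑ v ∈ T, localInvariantMap K (p ^ (m + 1)) v
                (galoisCohomology.localization (mu K (p ^ (m + 1))) (Sum.inr v) 2 y)).val * p ^ (e - m - 1) : ℕ) :
                ZMod (p ^ e)))) :
    ∀ (K : Type) [Field K] [NumberField K], IsImaginaryQuadratic K →
      poitouTate_sum_localTatePairing_eq_zero K := by
  intro K _ _ hK
  haveI : IsTotallyComplex K := hK.isTotallyComplex
  exact poitouTate_sum_localTatePairing_eq_zero_of_isTotallyComplex_of_correction K (hpre K hK)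

/-! ## 2. Crux B (stmt-19160) modulo the correction statement -/

/-- **Crux B `AnalyticRankOneOfRankOneFiniteShaThree` ⟸ (LB-exist) + (LB-wan) + (LB-bdp) + six refereed facts +
the correction statement at the imaginary quadratic fields** (`cruxB_of_bdpTriple_of_poitouTate_imaginaryQuadratic`,
p448851, with `hPT := poitouTate_imaginaryQuadratic_of_correction hpre`). CONDITIONAL; credits nothing.
[cite: CastellaGrossiLeeSkinner2022, §5.2 (proof of Thm. 5.2.1)] [cite: CasselsFrohlichANT1967, Ch. VII §11] -/
theorem cruxB_of_bdpTriple_of_correction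
    (hpar : ∀ (W : WeierstrassCurve ℚ) [W.IsElliptic] (p : ℕ) [Fact p.Prime], p_parity W p)
    (hmod : ModularForms.exists_isNewformOf) (hHL : HoffsteinLuo1997_exists_twist_L_one_ne_zero)
    (hKato : ∀ (W : WeierstrassCurve ℚ) [W.IsElliptic] (p : ℕ) [Fact p.Prime],
      kato_finite_of_L_one_ne_zero W p)
    (hHP : ∀ (W : WeierstrassCurve ℚ) (K : Type) [Field K] [NumberField K],
      exists_isHeegnerPoint W K)
    (hGZ : ∀ (W : WeierstrassCurve ℚ) (N : ℕ) [NeZero N] (K : Type) [Field K] [NumberField K],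
      analyticRankEK_eq_one_iff_heegner_nonTorsion W N K)
    (hpre : ∀ (K : Type) [Field K] [NumberField K], IsImaginaryQuadratic K →
      ∀ (p : ℕ) [Fact p.Prime] (m : ℕ) (y : galoisCohomology (mu K (p ^ (m + 1))) 2)
        (S : Finset (HeightOneSpectrum (𝓞 K))),
        (∀ v ∉ S, localInvariantMap K (p ^ (m + 1)) v
          (galoisCohomology.localization (mu K (p ^ (m + 1))) (Sum.inr v) 2 y) = 0) →
        ∃ e : ℕ, m + 1 ≤ e ∧ ∃ (y' : galoisCohomology (mu K (p ^ e)) 2) (S' : Finset (HeightOneSpectrum (𝓞 K))),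
          S ⊆ S' ∧
          (∀ v : HeightOneSpectrum (𝓞 K), (p : 𝓞 K) ∈ v.asIdeal →
            galoisCohomology.localization (mu K (p ^ e)) (Sum.inr v) 2 y' = 0) ∧
          (∀ v ∉ S', localInvariantMap K (p ^ e) v
            (galoisCohomology.localization (mu K (p ^ e)) (Sum.inr v) 2 y') = 0) ∧
          (∀ T : Finset (HeightOneSpectrum (𝓞 K)), S' ⊆ T →
            ∑ v ∈ T, localInvariantMap K (p ^ e) v (galoisCohomology.localization (mu K (p ^ e)) (Sum.inr v) 2 y') =
              (((∑ v ∈ T, localInvariantMap K (p ^ (m + 1)) v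
                (galoisCohomology.localization (mu K (p ^ (m + 1))) (Sum.inr v) 2 y)).val * p ^ (e - m - 1) : ℕ) :
                ZMod (p ^ e))))
    (hE : ThreeAdicBDPElementExists) (hWan : ThreeAdicWanDivisibility) (hV : ThreeAdicBDPValueAtOne) :
    AnalyticRankOneOfRankOneFiniteShaThree :=
  cruxB_of_bdpTriple_of_poitouTate_imaginaryQuadratic hpar hmod hHL hKato hHP hGZ
    (poitouTate_imaginaryQuadratic_of_correction hpre) hE hWan hV

/-- **Crux B ⟸ the ♯ triple (BDP statements UP TO NONZERO CONSTANTS) + six refereed facts + the correction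
statement at the imaginary quadratic fields** (`cruxB_of_bdpTripleUpTo_of_poitouTate_imaginaryQuadratic`, p450685).
CONDITIONAL; credits nothing. [cite: CastellaGrossiLeeSkinner2022, §5.2 (proof of Thm. 5.2.1)]
[cite: CasselsFrohlichANT1967, Ch. VII §11] -/
theorem cruxB_of_bdpTripleUpTo_of_correction
    (hpar : ∀ (W : WeierstrassCurve ℚ) [W.IsElliptic] (p : ℕ) [Fact p.Prime], p_parity W p)
    (hmod : ModularForms.exists_isNewformOf) (hHL : HoffsteinLuo1997_exists_twist_L_one_ne_zero)
    (hKato : ∀ (W : WeierstrassCurve ℚ) [W.IsElliptic] (p : ℕ) [Fact p.Prime],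
      kato_finite_of_L_one_ne_zero W p)
    (hHP : ∀ (W : WeierstrassCurve ℚ) (K : Type) [Field K] [NumberField K],
      exists_isHeegnerPoint W K)
    (hGZ : ∀ (W : WeierstrassCurve ℚ) (N : ℕ) [NeZero N] (K : Type) [Field K] [NumberField K],
      analyticRankEK_eq_one_iff_heegner_nonTorsion W N K)
    (hpre : ∀ (K : Type) [Field K] [NumberField K], IsImaginaryQuadratic K →
      ∀ (p : ℕ) [Fact p.Prime] (m : ℕ) (y : galoisCohomology (mu K (p ^ (m + 1))) 2)
        (S : Finset (HeightOneSpectrum (𝓞 K))),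
        (∀ v ∉ S, localInvariantMap K (p ^ (m + 1)) v
          (galoisCohomology.localization (mu K (p ^ (m + 1))) (Sum.inr v) 2 y) = 0) →
        ∃ e : ℕ, m + 1 ≤ e ∧ ∃ (y' : galoisCohomology (mu K (p ^ e)) 2) (S' : Finset (HeightOneSpectrum (𝓞 K))),
          S ⊆ S' ∧
          (∀ v : HeightOneSpectrum (𝓞 K), (p : 𝓞 K) ∈ v.asIdeal →
            galoisCohomology.localization (mu K (p ^ e)) (Sum.inr v) 2 y' = 0) ∧
          (∀ v ∉ S', localInvariantMap K (p ^ e) v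
            (galoisCohomology.localization (mu K (p ^ e)) (Sum.inr v) 2 y') = 0) ∧
          (∀ T : Finset (HeightOneSpectrum (𝓞 K)), S' ⊆ T →
            ∑ v ∈ T, localInvariantMap K (p ^ e) v (galoisCohomology.localization (mu K (p ^ e)) (Sum.inr v) 2 y') =
              (((∑ v ∈ T, localInvariantMap K (p ^ (m + 1)) v
                (galoisCohomology.localization (mu K (p ^ (m + 1))) (Sum.inr v) 2 y)).val * p ^ (e - m - 1) : ℕ) :
                ZMod (p ^ e))))
    (hE : ThreeAdicBDPElementExistsUpTo) (hWan : ThreeAdicWanDivisibilityUpTo)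
    (hV : ThreeAdicBDPValueAtOneUpTo) :
    AnalyticRankOneOfRankOneFiniteShaThree :=
  cruxB_of_bdpTripleUpTo_of_poitouTate_imaginaryQuadratic hpar hmod hHL hKato hHP hGZ
    (poitouTate_imaginaryQuadratic_of_correction hpre) hE hWan hV

/-! ## 3. The residual (stmt-19159) and the leaf modulo the correction statement -/

/-- **Crux A ⟺ (res) at `3` modulo the BDP triple, five refereed facts and the correction statement at the
imaginary quadratic fields** (`cruxA_iff_res_of_bdpTriple_of_poitouTate_imaginaryQuadratic`, p448851).
CONDITIONAL; credits nothing. [cite: Skinner2020, Thm. B and §2.2 (shape of (res))]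
[cite: CasselsFrohlichANT1967, Ch. VII §11] -/
theorem cruxA_iff_res_of_bdpTriple_of_correction
    (hpar : ∀ (W : WeierstrassCurve ℚ) [W.IsElliptic] (p : ℕ) [Fact p.Prime], p_parity W p)
    (hmod : ModularForms.exists_isNewformOf) (hHL : HoffsteinLuo1997_exists_twist_L_one_ne_zero)
    (hKato : ∀ (W : WeierstrassCurve ℚ) [W.IsElliptic] (p : ℕ) [Fact p.Prime],
      kato_finite_of_L_one_ne_zero W p)
    (hHP : ∀ (W : WeierstrassCurve ℚ) (K : Type) [Field K] [NumberField K],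
      exists_isHeegnerPoint W K)
    (hpre : ∀ (K : Type) [Field K] [NumberField K], IsImaginaryQuadratic K →
      ∀ (p : ℕ) [Fact p.Prime] (m : ℕ) (y : galoisCohomology (mu K (p ^ (m + 1))) 2)
        (S : Finset (HeightOneSpectrum (𝓞 K))),
        (∀ v ∉ S, localInvariantMap K (p ^ (m + 1)) v
          (galoisCohomology.localization (mu K (p ^ (m + 1))) (Sum.inr v) 2 y) = 0) →
        ∃ e : ℕ, m + 1 ≤ e ∧ ∃ (y' : galoisCohomology (mu K (p ^ e)) 2) (S' : Finset (HeightOneSpectrum (𝓞 K))),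
          S ⊆ S' ∧
          (∀ v : HeightOneSpectrum (𝓞 K), (p : 𝓞 K) ∈ v.asIdeal →
            galoisCohomology.localization (mu K (p ^ e)) (Sum.inr v) 2 y' = 0) ∧
          (∀ v ∉ S', localInvariantMap K (p ^ e) v
            (galoisCohomology.localization (mu K (p ^ e)) (Sum.inr v) 2 y') = 0) ∧
          (∀ T : Finset (HeightOneSpectrum (𝓞 K)), S' ⊆ T →
            ∑ v ∈ T, localInvariantMap K (p ^ e) v (galoisCohomology.localization (mu K (p ^ e)) (Sum.inr v) 2 y') =
              (((∑ v ∈ T, localInvariantMap K (p ^ (m + 1)) v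
                (galoisCohomology.localization (mu K (p ^ (m + 1))) (Sum.inr v) 2 y)).val * p ^ (e - m - 1) : ℕ) :
                ZMod (p ^ e))))
    (hE : ThreeAdicBDPElementExists) (hWan : ThreeAdicWanDivisibility) (hV : ThreeAdicBDPValueAtOne) :
    RankPosOfThreeSelmerCorankOne ↔
      ∀ (W : WeierstrassCurve ℚ) [W.IsElliptic] [W.IsGloballyMinimal], W.j = 0 →
        ∀ (K : Type) [Field K] [NumberField K],
        IsImaginaryQuadratic K → SatisfiesHeegnerHypothesis 3 K →
          (W.baseChange K).selmerCorank 3 = 1 →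
        ∀ (w : HeightOneSpectrum (𝓞 K)), ((3 : ℕ) : 𝓞 K) ∈ w.asIdeal →
          Finite ↥((W.baseChange K).selmerGroupPInfty 3 ⊓
            selmerLocalKerPrimaryTorsion (W.baseChange K) (w.adicCompletion K) 3) :=
  cruxA_iff_res_of_bdpTriple_of_poitouTate_imaginaryQuadratic hpar hmod hHL hKato hHP
    (poitouTate_imaginaryQuadratic_of_correction hpre) hE hWan hV

/-- **THE ROUTE'S KERNEL CENSUS modulo the correction statement: the leaf `rankOne_threeConverse_mordellCurve`
⟸ {(res) at `3`, (LB-exist), (LB-wan), (LB-bdp)} + six refereed facts + the correction statement at the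
imaginary quadratic fields** (`leaf_of_res_of_bdpTriple_of_poitouTate_imaginaryQuadratic`, p448851). CONDITIONAL;
neither BSD nor Sylvester's conjecture is touched. [cite: GrossZagier1986, Thm. I.6.3 with V.§2]
[cite: CasselsFrohlichANT1967, Ch. VII §11] -/
theorem leaf_of_res_of_bdpTriple_of_correction
    (hpar : ∀ (W : WeierstrassCurve ℚ) [W.IsElliptic] (p : ℕ) [Fact p.Prime], p_parity W p)
    (hmod : ModularForms.exists_isNewformOf) (hHL : HoffsteinLuo1997_exists_twist_L_one_ne_zero)
    (hKato : ∀ (W : WeierstrassCurve ℚ) [W.IsElliptic] (p : ℕ) [Fact p.Prime],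
      kato_finite_of_L_one_ne_zero W p)
    (hHP : ∀ (W : WeierstrassCurve ℚ) (K : Type) [Field K] [NumberField K],
      exists_isHeegnerPoint W K)
    (hGZ : ∀ (W : WeierstrassCurve ℚ) (N : ℕ) [NeZero N] (K : Type) [Field K] [NumberField K],
      analyticRankEK_eq_one_iff_heegner_nonTorsion W N K)
    (hpre : ∀ (K : Type) [Field K] [NumberField K], IsImaginaryQuadratic K →
      ∀ (p : ℕ) [Fact p.Prime] (m : ℕ) (y : galoisCohomology (mu K (p ^ (m + 1))) 2)
        (S : Finset (HeightOneSpectrum (𝓞 K))),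
        (∀ v ∉ S, localInvariantMap K (p ^ (m + 1)) v
          (galoisCohomology.localization (mu K (p ^ (m + 1))) (Sum.inr v) 2 y) = 0) →
        ∃ e : ℕ, m + 1 ≤ e ∧ ∃ (y' : galoisCohomology (mu K (p ^ e)) 2) (S' : Finset (HeightOneSpectrum (𝓞 K))),
          S ⊆ S' ∧
          (∀ v : HeightOneSpectrum (𝓞 K), (p : 𝓞 K) ∈ v.asIdeal →
            galoisCohomology.localization (mu K (p ^ e)) (Sum.inr v) 2 y' = 0) ∧
          (∀ v ∉ S', localInvariantMap K (p ^ e) v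
            (galoisCohomology.localization (mu K (p ^ e)) (Sum.inr v) 2 y') = 0) ∧
          (∀ T : Finset (HeightOneSpectrum (𝓞 K)), S' ⊆ T →
            ∑ v ∈ T, localInvariantMap K (p ^ e) v (galoisCohomology.localization (mu K (p ^ e)) (Sum.inr v) 2 y') =
              (((∑ v ∈ T, localInvariantMap K (p ^ (m + 1)) v
                (galoisCohomology.localization (mu K (p ^ (m + 1))) (Sum.inr v) 2 y)).val * p ^ (e - m - 1) : ℕ) :
                ZMod (p ^ e))))
    (hres : ∀ (W : WeierstrassCurve ℚ) [W.IsElliptic] [W.IsGloballyMinimal], W.j = 0 →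
      ∀ (K : Type) [Field K] [NumberField K],
      IsImaginaryQuadratic K → SatisfiesHeegnerHypothesis 3 K →
        (W.baseChange K).selmerCorank 3 = 1 →
      ∀ (w : HeightOneSpectrum (𝓞 K)), ((3 : ℕ) : 𝓞 K) ∈ w.asIdeal →
        Finite ↥((W.baseChange K).selmerGroupPInfty 3 ⊓
          selmerLocalKerPrimaryTorsion (W.baseChange K) (w.adicCompletion K) 3))
    (hE : ThreeAdicBDPElementExists) (hWan : ThreeAdicWanDivisibility) (hV : ThreeAdicBDPValueAtOne) :
    rankOne_threeConverse_mordellCurve :=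
  leaf_of_res_of_bdpTriple_of_poitouTate_imaginaryQuadratic hpar hmod hHL hKato hHP hGZ
    (poitouTate_imaginaryQuadratic_of_correction hpre) hres hE hWan hV

/-- **The same in the ♯ currency** (`leaf_of_res_of_bdpTripleUpTo_of_poitouTate_imaginaryQuadratic`, p451012).
CONDITIONAL; credits nothing. [cite: GrossZagier1986, Thm. I.6.3 with V.§2] [cite: CasselsFrohlichANT1967, Ch. VII §11] -/
theorem leaf_of_res_of_bdpTripleUpTo_of_correction
    (hpar : ∀ (W : WeierstrassCurve ℚ) [W.IsElliptic] (p : ℕ) [Fact p.Prime], p_parity W p)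
    (hmod : ModularForms.exists_isNewformOf) (hHL : HoffsteinLuo1997_exists_twist_L_one_ne_zero)
    (hKato : ∀ (W : WeierstrassCurve ℚ) [W.IsElliptic] (p : ℕ) [Fact p.Prime],
      kato_finite_of_L_one_ne_zero W p)
    (hHP : ∀ (W : WeierstrassCurve ℚ) (K : Type) [Field K] [NumberField K],
      exists_isHeegnerPoint W K)
    (hGZ : ∀ (W : WeierstrassCurve ℚ) (N : ℕ) [NeZero N] (K : Type) [Field K] [NumberField K],
      analyticRankEK_eq_one_iff_heegner_nonTorsion W N K)
    (hpre : ∀ (K : Type) [Field K] [NumberField K], IsImaginaryQuadratic K →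
      ∀ (p : ℕ) [Fact p.Prime] (m : ℕ) (y : galoisCohomology (mu K (p ^ (m + 1))) 2)
        (S : Finset (HeightOneSpectrum (𝓞 K))),
        (∀ v ∉ S, localInvariantMap K (p ^ (m + 1)) v
          (galoisCohomology.localization (mu K (p ^ (m + 1))) (Sum.inr v) 2 y) = 0) →
        ∃ e : ℕ, m + 1 ≤ e ∧ ∃ (y' : galoisCohomology (mu K (p ^ e)) 2) (S' : Finset (HeightOneSpectrum (𝓞 K))),
          S ⊆ S' ∧
          (∀ v : HeightOneSpectrum (𝓞 K), (p : 𝓞 K) ∈ v.asIdeal →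
            galoisCohomology.localization (mu K (p ^ e)) (Sum.inr v) 2 y' = 0) ∧
          (∀ v ∉ S', localInvariantMap K (p ^ e) v
            (galoisCohomology.localization (mu K (p ^ e)) (Sum.inr v) 2 y') = 0) ∧
          (∀ T : Finset (HeightOneSpectrum (𝓞 K)), S' ⊆ T →
            ∑ v ∈ T, localInvariantMap K (p ^ e) v (galoisCohomology.localization (mu K (p ^ e)) (Sum.inr v) 2 y') =
              (((∑ v ∈ T, localInvariantMap K (p ^ (m + 1)) v
                (galoisCohomology.localization (mu K (p ^ (m + 1))) (Sum.inr v) 2 y)).val * p ^ (e - m - 1) : ℕ) :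
                ZMod (p ^ e))))
    (hres : ∀ (W : WeierstrassCurve ℚ) [W.IsElliptic] [W.IsGloballyMinimal], W.j = 0 →
      ∀ (K : Type) [Field K] [NumberField K],
      IsImaginaryQuadratic K → SatisfiesHeegnerHypothesis 3 K →
        (W.baseChange K).selmerCorank 3 = 1 →
      ∀ (w : HeightOneSpectrum (𝓞 K)), ((3 : ℕ) : 𝓞 K) ∈ w.asIdeal →
        Finite ↥((W.baseChange K).selmerGroupPInfty 3 ⊓
          selmerLocalKerPrimaryTorsion (W.baseChange K) (w.adicCompletion K) 3))
    (hE : ThreeAdicBDPElementExistsUpTo) (hWan : ThreeAdicWanDivisibilityUpTo)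
    (hV : ThreeAdicBDPValueAtOneUpTo) :
    rankOne_threeConverse_mordellCurve :=
  leaf_of_res_of_bdpTripleUpTo_of_poitouTate_imaginaryQuadratic hpar hmod hHL hKato hHP hGZ
    (poitouTate_imaginaryQuadratic_of_correction hpre) hres hE hWan hV

end Summit.BirchSwinnertonDyer.BirchSwinnertonDyer.Theorems.MordellShaFreeCutCensusModCorrection

end
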